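import Mathlib.MeasureTheory.Group.Measure
import Mathlib.MeasureTheory.Integral.Bochner.Basic
import Mathlib.Topology.Separation.Hausdorff
import Literature.NumberTheory.Li1992.RallisInnerProduct
import HarnessLib

/-!
# Genuine descent along a split finite central cover — the kernel passage behind [Li1992, Thm 2.1]

Topic `NumberTheory/Li1992`; namespace `Literature.NumberTheory.Li1992` (continues `RallisInnerProduct`).

Setting AS PRINTED [Li1992, p. 178]: "let `Sp̃(W)_𝔸` be the metaplectic two-fold cover of `Sp(W)_𝔸` …
Let `G̃(𝔸)` and `G̃'(𝔸)` respectively be the inverse images of `G(𝔸)` and `G'(𝔸)` in `Sp̃(W)_𝔸`", and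
"We shall assume `π` to be non-trivial on the kernel of the covering `G̃'(𝔸) → G'(𝔸)`.  Most time this
covering is almost trivial, so `π` is more or less a representation of `G'(𝔸)`."  Rallis' inner product
formula [Li1992, Thm 2.1 (26) p. 184] (`Li92Datum.RallisInnerProductFormula`) is an identity of the shape
`⟨θ^{f₁}_{φ₁}, θ^{f₂}_{φ₂}⟩ = ∫_{G̃'(𝔸)} ⟨ω(h)φ₁, φ₂⟩ ⟨π(h)f₁, f₂⟩ dh` over the COVERING group `G̃'(𝔸)`.

This file is the purely group- and measure-theoretic passage from the covering group to the group itself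
when the covering SPLITS — the situation of a unitary dual pair, where the metaplectic cover restricted
to `U(W)(𝔸)` is split by an explicit continuous homomorphism ([Kudla1994, Thm 3.1], [HarrisKudlaSweet1996,
(1.14)]).  Abstractly: `p : G̃ →* G` with a homomorphic section `s : G →* G̃` (`p ∘ s = id`) whose kernel
`Z` is finite and central; `ω`, `π` are GENUINE, i.e. `Z` acts through characters `χ`, `χ'` with
`χ · χ' = 1` on `Z` (for the two-fold cover: both act by the sign character).  Then

* `kerProdEquiv`, `kerProdMulEquiv` : `G̃ = Z · s(G)` uniquely — `Z × G ≃* G̃`, `(z, g) ↦ z · s(g)`;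
* `liftMeasure s Z μ = Σ_{z ∈ Z} (g ↦ z · s g)_* μ` : the measure on `G̃` lifted from a measure `μ` on
  `G`; it is a HAAR measure when `μ` is (`isHaarMeasure_liftMeasure`: left-invariant, finite on
  compacts, positive on opens), so it is a legitimate choice of "`dh`" on `G̃'(𝔸)`;
* `integral_liftMeasure` : for a `Z`-invariant integrand, `∫_{G̃} F dμ̃ = |Z| · ∫_G F(s g) dμ(g)`
  (unconditionally: both sides are junk `0` together);
* `Li92Datum.integrand_eq_of_genuine` : Li's integrand `h ↦ ⟨ω(h)φ₁, φ₂⟩⟨π(h)f₁, f₂⟩` is `Z`-invariant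
  for genuine `(ω, π)`;
* `Li92Datum.comap` and `RallisInnerProductFormula.comap_of_genuine` / `.descend` : formula (26) for the
  datum on `G̃'(𝔸)` with `dh = liftMeasure` implies formula (26) for the pulled-back datum
  `(ω ∘ s, π ∘ s)` on `G'(𝔸)` with Haar functional `|Z| · ∫_G · dμ`.

So the CITED record [Li1992, Thm 2.1] can be instantiated verbatim on Li's printed objects (the covering
group, genuine `π`), and its use on `U(W)(𝔸)` itself is a kernel corollary.  Everything here is proved;
tags are provenance only.  Deliberately NOT here: the metaplectic group, Kudla's splitting, any theta
series — those are the instantiating data.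
-/

open MeasureTheory Function

namespace Literature.NumberTheory.Li1992

/-! ## 1. Algebra of a split extension with central kernel -/

section Algebra

variable {Gt G : Type*} [Group Gt] [Group G] (p : Gt →* G) (s : G →* Gt)

/-- The kernel component `z(x) = x · s(p x)⁻¹` of `x ∈ G̃`. [folklore] -/
def kerPart (x : Gt) : Gt := x * (s (p x))⁻¹

/-- `z(x) ∈ ker p` when `s` is a section of `p`. [folklore] -/
theorem kerPart_mem_ker (hs : ∀ g, p (s g) = g) (x : Gt) : kerPart p s x ∈ p.ker := by
  rw [MonoidHom.mem_ker, kerPart, map_mul, map_inv, hs, mul_inv_cancel]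

/-- `x = z(x) · s(p x)`. [folklore] -/
theorem kerPart_mul_section (x : Gt) : kerPart p s x * s (p x) = x := by
  rw [kerPart, inv_mul_cancel_right]

/-- `p (z · s g) = g` for `z ∈ ker p`. [folklore] -/
theorem apply_ker_mul_section (hs : ∀ g, p (s g) = g) {z : Gt} (hz : z ∈ p.ker) (g : G) :
    p (z * s g) = g := by
  rw [map_mul, (MonoidHom.mem_ker).1 hz, one_mul, hs]

/-- `z(z · s g) = z` for `z ∈ ker p`. [folklore] -/
theorem kerPart_ker_mul_section (hs : ∀ g, p (s g) = g) {z : Gt} (hz : z ∈ p.ker) (g : G) :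
    kerPart p s (z * s g) = z := by
  rw [kerPart, apply_ker_mul_section p s hs hz, mul_inv_cancel_right]

/-- Uniqueness of the decomposition `x = z · s(g)`. [folklore] -/
theorem ker_mul_section_injective (hs : ∀ g, p (s g) = g) {z z' : Gt} (hz : z ∈ p.ker)
    (hz' : z' ∈ p.ker) {g g' : G} (h : z * s g = z' * s g') : z = z' ∧ g = g' := by
  have hg : g = g' := by
    have := congrArg p h
    rwa [apply_ker_mul_section p s hs hz, apply_ker_mul_section p s hs hz'] at this
  subst hg
  exact ⟨mul_right_cancel h, rfl⟩

/-- **`G̃ = Z · s(G)` uniquely**: the bijection `ker p × G ≃ G̃`, `(z, g) ↦ z · s(g)`, with inverse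
`x ↦ (x · s(p x)⁻¹, p x)`. [folklore] -/
def kerProdEquiv (hs : ∀ g, p (s g) = g) : p.ker × G ≃ Gt where
  toFun zg := (zg.1 : Gt) * s zg.2
  invFun x := (⟨kerPart p s x, kerPart_mem_ker p s hs x⟩, p x)
  left_inv := by
    rintro ⟨⟨z, hz⟩, g⟩
    simp only [Prod.mk.injEq, Subtype.mk.injEq]
    exact ⟨kerPart_ker_mul_section p s hs hz g, apply_ker_mul_section p s hs hz g⟩
  right_inv x := kerPart_mul_section p s x

/-- `kerProdEquiv (z, g) = z · s g`. [folklore] -/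
@[simp] theorem kerProdEquiv_apply (hs : ∀ g, p (s g) = g) (zg : p.ker × G) :
    kerProdEquiv p s hs zg = (zg.1 : Gt) * s zg.2 := rfl

/-- With `ker p` CENTRAL (a central extension), `(z, g) ↦ z · s(g)` is a group isomorphism
`ker p × G ≃* G̃`. [folklore] -/
def kerProdMulEquiv (hs : ∀ g, p (s g) = g) (hcent : ∀ z ∈ p.ker, ∀ x : Gt, z * x = x * z) :
    p.ker × G ≃* Gt :=
  { kerProdEquiv p s hs with
    map_mul' := by
      rintro ⟨⟨z, hz⟩, g⟩ ⟨⟨z', hz'⟩, g'⟩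
      show (z * z') * s (g * g') = (z * s g) * (z' * s g')
      rw [map_mul, show (z * s g) * (z' * s g') = z * ((s g * z') * s g') by simp only [mul_assoc],
        ← hcent z' hz' (s g)]
      simp only [mul_assoc] }

end Algebra

/-! ## 2. The lifted Haar measure and the transport of integrals -/

section Measure

variable {Gt G : Type*} [Group Gt] [Group G] (p : Gt →* G) (s : G →* Gt)

/-- The translate of the section by `z`: `t_z(g) = z · s(g)`. [folklore] -/
def sectionTranslate (z : Gt) (g : G) : Gt := z * s g

/-- `t_z(g) = z · s g`. [folklore] -/
@[simp] theorem sectionTranslate_apply (z : Gt) (g : G) : sectionTranslate s z g = z * s g := rfl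

variable [TopologicalSpace Gt] [TopologicalSpace G]

/-- `t_z` is continuous when `s` is. [folklore] -/
theorem continuous_sectionTranslate [ContinuousMul Gt] (hsc : Continuous s) (z : Gt) :
    Continuous (sectionTranslate s z) :=
  continuous_const.mul hsc

/-- `t_z` is a closed embedding `G → G̃` (it has the continuous left inverse `p`). [folklore] -/
theorem isClosedEmbedding_sectionTranslate [ContinuousMul Gt] [T2Space Gt] (hpc : Continuous p)
    (hsc : Continuous s) (hs : ∀ g, p (s g) = g) {z : Gt} (hz : z ∈ p.ker) :
    Topology.IsClosedEmbedding (sectionTranslate s z) :=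
  Function.LeftInverse.isClosedEmbedding (f := p) (fun g => apply_ker_mul_section p s hs hz g) hpc
    (continuous_sectionTranslate s hsc z)

variable [MeasurableSpace Gt] [MeasurableSpace G] [BorelSpace Gt] [BorelSpace G]

/-- `t_z` is (Borel) measurable when `s` is continuous. [folklore] -/
theorem measurable_sectionTranslate [ContinuousMul Gt] (hsc : Continuous s) (z : Gt) :
    Measurable (sectionTranslate s z) :=
  (continuous_sectionTranslate s hsc z).measurable

/-- **The lifted measure** `μ̃ = Σ_{z ∈ Z} (t_z)_* μ` on `G̃` (for `Z = ker p`: the image of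
`(counting measure on Z) ⊗ μ` under `Z × G ≃ G̃`). [folklore] -/
noncomputable def liftMeasure (Z : Finset Gt) (μ : Measure G) : Measure Gt :=
  ∑ z ∈ Z, μ.map (sectionTranslate s z)

/-- **Transport of integrals**: for a `Z`-invariant integrand,
`∫_{G̃} F dμ̃ = |Z| · ∫_G F(s g) dμ(g)` — with no integrability hypothesis (if one side is a junk `0`
so is the other). [folklore] -/
theorem integral_liftMeasure [ContinuousMul Gt] [T2Space Gt] (hpc : Continuous p) (hsc : Continuous s)
    (hs : ∀ g, p (s g) = g) {Z : Finset Gt} (hZ : ∀ z ∈ Z, z ∈ p.ker) (μ : Measure G)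
    {E : Type*} [NormedAddCommGroup E] [NormedSpace ℝ E] [CompleteSpace E] (F : Gt → E)
    (hF : ∀ z ∈ Z, ∀ x, F (z * x) = F x) :
    ∫ x, F x ∂(liftMeasure s Z μ) = (Z.card : ℝ) • ∫ g, F (s g) ∂μ := by
  have hemb : ∀ z ∈ Z, MeasurableEmbedding (sectionTranslate s z) := fun z hz =>
    (isClosedEmbedding_sectionTranslate p s hpc hsc hs (hZ z hz)).measurableEmbedding
  have hcomp : ∀ z ∈ Z, (fun g => F (sectionTranslate s z g)) = fun g => F (s g) := fun z hz =>
    funext fun g => hF z hz (s g)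
  unfold liftMeasure
  by_cases hint : Integrable (fun g => F (s g)) μ
  · have hint' : ∀ z ∈ Z, Integrable F (μ.map (sectionTranslate s z)) := fun z hz => by
      rw [(hemb z hz).integrable_map_iff, Function.comp_def, hcomp z hz]
      exact hint
    rw [integral_finsetSum_measure hint',
      Finset.sum_congr rfl fun z hz => by rw [(hemb z hz).integral_map, hcomp z hz],
      Finset.sum_const, ← Nat.cast_smul_eq_nsmul ℝ]
  · rw [integral_undef hint, smul_zero]
    by_cases hZe : Z = ∅
    · simp [hZe]
    · obtain ⟨z, hz⟩ := Finset.nonempty_iff_ne_empty.2 hZe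
      apply integral_undef
      intro hI
      have h1 := (integrable_finsetSum_measure.1 hI) z hz
      rw [(hemb z hz).integrable_map_iff, Function.comp_def, hcomp z hz] at h1
      exact hint h1

/-- The lifted measure is finite on compact sets when `μ` is. [folklore] -/
theorem isFiniteMeasureOnCompacts_liftMeasure [ContinuousMul Gt] [T2Space Gt] (hpc : Continuous p)
    (hsc : Continuous s) (hs : ∀ g, p (s g) = g) {Z : Finset Gt} (hZ : ∀ z ∈ Z, z ∈ p.ker)
    (μ : Measure G) [IsFiniteMeasureOnCompacts μ] : IsFiniteMeasureOnCompacts (liftMeasure s Z μ) := by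
  refine ⟨fun K hK => ?_⟩
  unfold liftMeasure
  rw [Measure.finsetSum_apply]
  refine ENNReal.sum_lt_top.2 fun z hz => ?_
  rw [Measure.map_apply (measurable_sectionTranslate s hsc z) hK.measurableSet]
  refine lt_of_le_of_lt (measure_mono fun g hg => ?_) (hK.image hpc).measure_lt_top
  exact ⟨z * s g, hg, apply_ker_mul_section p s hs (hZ z hz) g⟩

/-- The lifted measure is positive on non-empty open sets when `μ` is and `Z = ker p`. [folklore] -/
theorem isOpenPosMeasure_liftMeasure [ContinuousMul Gt] (hsc : Continuous s) (hs : ∀ g, p (s g) = g)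
    {Z : Finset Gt} (hZ : ∀ z, z ∈ Z ↔ z ∈ p.ker) (μ : Measure G) [μ.IsOpenPosMeasure] :
    (liftMeasure s Z μ).IsOpenPosMeasure := by
  refine ⟨fun U hU hne => ?_⟩
  obtain ⟨x, hx⟩ := hne
  obtain ⟨⟨⟨z₀, hz₀⟩, g₀⟩, rfl⟩ := (kerProdEquiv p s hs).surjective x
  unfold liftMeasure
  rw [Measure.finsetSum_apply]
  refine ne_of_gt (lt_of_lt_of_le ?_
    (Finset.single_le_sum (f := fun z => μ.map (sectionTranslate s z) U) (fun _ _ => zero_le)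
      ((hZ z₀).2 hz₀)))
  rw [Measure.map_apply (measurable_sectionTranslate s hsc z₀) hU.measurableSet]
  exact (hU.preimage (continuous_sectionTranslate s hsc z₀)).measure_pos μ ⟨g₀, hx⟩

/-- Left translation by `x = z₀ · s(g₀)` acts on the summands of `μ̃` by `t_z ↦ t_{z₀ z}` after the
left translation `g ↦ g₀ g` downstairs (uses that `ker p` is central). [folklore] -/
theorem map_mul_left_map_sectionTranslate [IsTopologicalGroup Gt] [IsTopologicalGroup G]
    (hsc : Continuous s) (hcent : ∀ z ∈ p.ker, ∀ x : Gt, z * x = x * z) {z₀ : Gt} (g₀ : G) {z : Gt}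
    (hz : z ∈ p.ker) (μ : Measure G) [μ.IsMulLeftInvariant] :
    (μ.map (sectionTranslate s z)).map (fun y => (z₀ * s g₀) * y) = μ.map (sectionTranslate s (z₀ * z)) := by
  rw [Measure.map_map (measurable_const_mul _) (measurable_sectionTranslate s hsc z)]
  have hfun : (fun y => (z₀ * s g₀) * y) ∘ sectionTranslate s z =
      sectionTranslate s (z₀ * z) ∘ fun g => g₀ * g := by
    funext g
    simp only [comp_apply, sectionTranslate_apply, map_mul]
    rw [show z₀ * s g₀ * (z * s g) = z₀ * ((s g₀ * z) * s g) by simp only [mul_assoc],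
      ← hcent z hz (s g₀)]
    simp only [mul_assoc]
  rw [hfun, ← Measure.map_map (measurable_sectionTranslate s hsc _) (measurable_const_mul g₀),
    map_mul_left_eq_self]

/-- **The lifted measure is left-invariant** when `μ` is, `Z = ker p` and `ker p` is central. [folklore] -/
theorem isMulLeftInvariant_liftMeasure [IsTopologicalGroup Gt] [IsTopologicalGroup G]
    (hsc : Continuous s) (hs : ∀ g, p (s g) = g) (hcent : ∀ z ∈ p.ker, ∀ x : Gt, z * x = x * z)
    {Z : Finset Gt} (hZ : ∀ z, z ∈ Z ↔ z ∈ p.ker) (μ : Measure G) [μ.IsMulLeftInvariant] :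
    (liftMeasure s Z μ).IsMulLeftInvariant := by
  refine ⟨fun x => ?_⟩
  obtain ⟨⟨⟨z₀, hz₀⟩, g₀⟩, rfl⟩ := (kerProdEquiv p s hs).surjective x
  simp only [kerProdEquiv_apply]
  unfold liftMeasure
  rw [← Measure.mapₗ_apply_of_measurable (measurable_const_mul _), map_sum]
  rw [Finset.sum_congr rfl fun z hz => by
    rw [Measure.mapₗ_apply_of_measurable (measurable_const_mul _),
      map_mul_left_map_sectionTranslate p s hsc hcent g₀ ((hZ z).1 hz) μ]]
  refine Finset.sum_nbij (fun z => z₀ * z) (fun z hz => (hZ _).2 (p.ker.mul_mem hz₀ ((hZ z).1 hz)))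
    (fun a _ b _ h => mul_left_cancel h) (fun w hw => ?_) (fun _ _ => rfl)
  refine ⟨z₀⁻¹ * w, ?_, by simp⟩
  exact (hZ _).2 (p.ker.mul_mem (p.ker.inv_mem hz₀) ((hZ w).1 hw))

/-- **The lifted measure is a Haar measure** on `G̃` when `μ` is a Haar measure on `G` (continuous
`p`, `s`; `Z = ker p` finite central).  So `dh := liftMeasure s Z μ` is an admissible Haar measure on
Li's `G̃'(𝔸)`. [folklore] -/
theorem isHaarMeasure_liftMeasure [IsTopologicalGroup Gt] [IsTopologicalGroup G] [T2Space Gt]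
    (hpc : Continuous p) (hsc : Continuous s) (hs : ∀ g, p (s g) = g)
    (hcent : ∀ z ∈ p.ker, ∀ x : Gt, z * x = x * z) {Z : Finset Gt} (hZ : ∀ z, z ∈ Z ↔ z ∈ p.ker)
    (μ : Measure G) [μ.IsHaarMeasure] : (liftMeasure s Z μ).IsHaarMeasure :=
  { toIsFiniteMeasureOnCompacts :=
      isFiniteMeasureOnCompacts_liftMeasure p s hpc hsc hs (fun z hz => (hZ z).1 hz) μ
    toIsMulLeftInvariant := isMulLeftInvariant_liftMeasure p s hsc hs hcent hZ μ
    toIsOpenPosMeasure := isOpenPosMeasure_liftMeasure p s hsc hs hZ μ }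

end Measure

/-! ## 3. Transport of Rallis' inner product formula [Li1992, Thm 2.1] along the splitting -/

section Transport

open scoped InnerProductSpace

variable {Gt G S Hπ L2G : Type*} [NormedAddCommGroup S] [InnerProductSpace ℂ S]
  [NormedAddCommGroup Hπ] [InnerProductSpace ℂ Hπ]

namespace Li92Datum

/-- **Pull-back of a Li datum** along a map `s : G → G̃` (the splitting), with a prescribed Haar
functional on `G`: `ω ↦ ω ∘ s`, `π ↦ π ∘ s`, the lifts `θ^f_φ` and the numerical data unchanged
(the theta lift `θ^f_φ ∈ L²(G(k)\G̃(𝔸))` does not depend on how `G̃'(𝔸)` is presented). [folklore] -/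
def comap (D : Li92Datum Gt S Hπ L2G) (s : G → Gt) (haarG : (G → ℂ) → ℂ) : Li92Datum G S Hπ L2G where
  ω g := D.ω (s g)
  π g := D.π (s g)
  lift := D.lift
  haar := haarG
  n := D.n
  n' := D.n'
  d := D.d
  d₀ := D.d₀

/-- `(D.comap s haarG).ω = D.ω ∘ s`. [folklore] -/
@[simp] theorem comap_ω (D : Li92Datum Gt S Hπ L2G) (s : G → Gt) (haarG : (G → ℂ) → ℂ) (g : G) :
    (D.comap s haarG).ω g = D.ω (s g) := rfl

/-- `(D.comap s haarG).π = D.π ∘ s`. [folklore] -/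
@[simp] theorem comap_π (D : Li92Datum Gt S Hπ L2G) (s : G → Gt) (haarG : (G → ℂ) → ℂ) (g : G) :
    (D.comap s haarG).π g = D.π (s g) := rfl

/-- The lifts are unchanged under `comap`. [folklore] -/
@[simp] theorem comap_lift (D : Li92Datum Gt S Hπ L2G) (s : G → Gt) (haarG : (G → ℂ) → ℂ) :
    (D.comap s haarG).lift = D.lift := rfl

/-- The Haar functional of `D.comap s haarG` is `haarG`. [folklore] -/
@[simp] theorem comap_haar (D : Li92Datum Gt S Hπ L2G) (s : G → Gt) (haarG : (G → ℂ) → ℂ) :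
    (D.comap s haarG).haar = haarG := rfl

/-- The numerical range condition `n > 2n' + 4ε − 2` is unchanged under `comap`. [folklore] -/
theorem comap_convergentRange_iff (D : Li92Datum Gt S Hπ L2G) (s : G → Gt) (haarG : (G → ℂ) → ℂ) :
    (D.comap s haarG).convergentRange ↔ D.convergentRange := Iff.rfl

variable [Mul Gt]

/-- **Genuine pairs have `Z`-invariant matrix-coefficient products.**  If `Z` acts in `ω` through
`χ` and in `π` through `χ'` with `χ χ' = 1` on `Z` (Li p. 178: `π` "non-trivial on the kernel of the
covering", `ω` genuine — for the two-fold cover both act by the sign character), then Li's integrand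
`h ↦ ⟨ω(h)φ₁, φ₂⟩ ⟨π(h)f₁, f₂⟩` satisfies `I(z h) = I(h)`. [folklore] -/
theorem integrand_eq_of_genuine (D : Li92Datum Gt S Hπ L2G) {Z : Set Gt} {χ χ' : Gt → ℂ}
    (hω : ∀ z ∈ Z, ∀ x, D.ω (z * x) = χ z • D.ω x) (hπ : ∀ z ∈ Z, ∀ x, D.π (z * x) = χ' z • D.π x)
    (hχ : ∀ z ∈ Z, χ z * χ' z = 1) {z : Gt} (hz : z ∈ Z) (x : Gt) (φ₁ φ₂ : S) (f₁ f₂ : Hπ) :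
    ⟪φ₂, D.ω (z * x) φ₁⟫_ℂ * ⟪f₂, D.π (z * x) f₁⟫_ℂ = ⟪φ₂, D.ω x φ₁⟫_ℂ * ⟪f₂, D.π x f₁⟫_ℂ := by
  rw [hω z hz x, hπ z hz x, LinearMap.smul_apply, LinearMap.smul_apply, inner_smul_right,
    inner_smul_right]
  calc χ z * ⟪φ₂, D.ω x φ₁⟫_ℂ * (χ' z * ⟪f₂, D.π x f₁⟫_ℂ)
        = (χ z * χ' z) * (⟪φ₂, D.ω x φ₁⟫_ℂ * ⟪f₂, D.π x f₁⟫_ℂ) := by ring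
    _ = ⟪φ₂, D.ω x φ₁⟫_ℂ * ⟪f₂, D.π x f₁⟫_ℂ := by rw [hχ z hz, one_mul]

/-- **Rallis' inner product formula descends along a splitting (abstract Haar functionals).**
If (26) holds for the datum `D` on `G̃'(𝔸)`, `(ω, π)` is genuine for `Z`, and the Haar functional of
`G̃'(𝔸)` agrees with `haarG ∘ (· ∘ s)` on `Z`-invariant functions, then (26) holds for the pulled-back
datum `D.comap s haarG` on `G'(𝔸)`:
`⟨θ^{f₁}_{φ₁}, θ^{f₂}_{φ₂}⟩ = haarG (g ↦ ⟨ω(s g)φ₁, φ₂⟩ ⟨π(s g)f₁, f₂⟩)`. [folklore] -/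
theorem RallisInnerProductFormula.comap_of_genuine [NormedAddCommGroup L2G] [InnerProductSpace ℂ L2G]
    {D : Li92Datum Gt S Hπ L2G} (h : D.RallisInnerProductFormula) (s : G → Gt) {Z : Set Gt} {χ χ' : Gt → ℂ}
    (hω : ∀ z ∈ Z, ∀ x, D.ω (z * x) = χ z • D.ω x) (hπ : ∀ z ∈ Z, ∀ x, D.π (z * x) = χ' z • D.π x)
    (hχ : ∀ z ∈ Z, χ z * χ' z = 1) {haarG : (G → ℂ) → ℂ}
    (hhaar : ∀ F : Gt → ℂ, (∀ z ∈ Z, ∀ x, F (z * x) = F x) → D.haar F = haarG fun g => F (s g)) :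
    (D.comap s haarG).RallisInnerProductFormula := by
  intro hcr φ₁ φ₂ f₁ f₂
  have key := h ((D.comap_convergentRange_iff s haarG).1 hcr) φ₁ φ₂ f₁ f₂
  simp only [comap_lift, comap_haar, comap_ω, comap_π]
  rw [key]
  exact hhaar _ fun z hz x => D.integrand_eq_of_genuine hω hπ hχ hz x φ₁ φ₂ f₁ f₂

end Li92Datum

/-- **Rallis' inner product formula descends along a splitting (Haar measures).**  `p : G̃ →* G` a
continuous surjection with finite central kernel `Z = ker p` (listed by the finset `Z`), split by a
continuous homomorphism `s`; `μ` a measure on `G` and `dh := liftMeasure s Z μ` the lifted (Haar, by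
`isHaarMeasure_liftMeasure`) measure on `G̃`, which is the Haar functional of the datum `D`; `(ω, π)`
genuine.  Then formula (26) for `D` — the CITED hypothesis [Li1992, Thm 2.1], on Li's printed objects —
gives formula (26) for `D.comap s` with Haar functional `F ↦ |Z| · ∫_G F dμ`:
`⟨θ^{f₁}_{φ₁}, θ^{f₂}_{φ₂}⟩ = |Z| · ∫_{G'(𝔸)} ⟨ω(s g)φ₁, φ₂⟩ ⟨π(s g)f₁, f₂⟩ dμ(g)`. [folklore] -/
theorem Li92Datum.RallisInnerProductFormula.descend [NormedAddCommGroup L2G] [InnerProductSpace ℂ L2G]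
    {Gt G : Type*} [Group Gt] [Group G]
    [TopologicalSpace Gt] [TopologicalSpace G] [MeasurableSpace Gt] [MeasurableSpace G] [BorelSpace Gt]
    [BorelSpace G] [ContinuousMul Gt] [T2Space Gt] (p : Gt →* G) (s : G →* Gt) (hpc : Continuous p)
    (hsc : Continuous s) (hs : ∀ g, p (s g) = g) {Z : Finset Gt} (hZ : ∀ z ∈ Z, z ∈ p.ker)
    (μ : Measure G) {D : Li92Datum Gt S Hπ L2G} (hD : D.haar = fun F => ∫ x, F x ∂(liftMeasure s Z μ))
    (h : D.RallisInnerProductFormula) {χ χ' : Gt → ℂ}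
    (hω : ∀ z ∈ p.ker, ∀ x, D.ω (z * x) = χ z • D.ω x) (hπ : ∀ z ∈ p.ker, ∀ x, D.π (z * x) = χ' z • D.π x)
    (hχ : ∀ z ∈ p.ker, χ z * χ' z = 1) :
    (D.comap s fun F => (Z.card : ℂ) * ∫ g, F g ∂μ).RallisInnerProductFormula := by
  refine h.comap_of_genuine s (Z := (p.ker : Set Gt)) hω hπ hχ fun F hF => ?_
  rw [hD]
  simp only
  rw [integral_liftMeasure p s hpc hsc hs hZ μ F fun z hz x => hF z (hZ z hz) x, Complex.real_smul,
    Complex.ofReal_natCast]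

/-- **Non-vanishing, descended.**  Under the hypotheses of `descend`: if
`|Z| · ∫_G ⟨ω(s g)φ, φ⟩ ⟨π(s g) f, f⟩ dμ(g)` is a positive real number then `θ^f_φ ≠ 0`
(`RallisInnerProductFormula.lift_ne_zero_of_pos` for the descended datum). [folklore] -/
theorem Li92Datum.RallisInnerProductFormula.lift_ne_zero_of_descend_pos [NormedAddCommGroup L2G]
    [InnerProductSpace ℂ L2G] {Gt G : Type*} [Group Gt] [Group G] [TopologicalSpace Gt] [TopologicalSpace G] [MeasurableSpace Gt] [MeasurableSpace G]
    [BorelSpace Gt] [BorelSpace G] [ContinuousMul Gt] [T2Space Gt] (p : Gt →* G) (s : G →* Gt)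
    (hpc : Continuous p) (hsc : Continuous s) (hs : ∀ g, p (s g) = g) {Z : Finset Gt}
    (hZ : ∀ z ∈ Z, z ∈ p.ker) (μ : Measure G) {D : Li92Datum Gt S Hπ L2G}
    (hD : D.haar = fun F => ∫ x, F x ∂(liftMeasure s Z μ)) (h : D.RallisInnerProductFormula)
    (hcr : D.convergentRange) {χ χ' : Gt → ℂ} (hω : ∀ z ∈ p.ker, ∀ x, D.ω (z * x) = χ z • D.ω x)
    (hπ : ∀ z ∈ p.ker, ∀ x, D.π (z * x) = χ' z • D.π x) (hχ : ∀ z ∈ p.ker, χ z * χ' z = 1)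
    {φ : S} {f : Hπ} {t : ℝ} (ht : 0 < t)
    (hI : (Z.card : ℂ) * ∫ g, ⟪φ, D.ω (s g) φ⟫_ℂ * ⟪f, D.π (s g) f⟫_ℂ ∂μ = (t : ℂ)) :
    D.lift φ f ≠ 0 :=
  (h.descend p s hpc hsc hs hZ μ hD hω hπ hχ).lift_ne_zero_of_pos
    ((D.comap_convergentRange_iff s _).2 hcr) ht hI

end Transport

end Literature.NumberTheory.Li1992
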